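import Summits.CriticalPhenomena.CardyFormulaZ2.Theorems.CardyIKTransportIKMixedBoxCrossingTransportDefs

/-!
# Stub `stub_cylPlane` (line `defect-closure-exploration`, crux `IKMixedBoxCrossing`, stmt-CriticalPhenomena-5911) —
# helper 1: the ROW CHAIN of the slab colour law (`d`-step kernel, explicit product form, `L∞` mixing bound)

Support file (`--supports stmt-CriticalPhenomena-5911`) for the registered stub `stub_cylPlane : CylPlane` of
`Theorems/CardyIKTransportIKMixedBoxCrossingTransportDefs.lean`.

Summing the flag of a face of the slab out of `faceWeight` leaves the COLOUR weight `gf τ_j odd = t^[odd]` on an isotropic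
face (`t = √3/2`) and `1` on a honeycomb face; the weight of two consecutive rows `η, η'` of the slab is therefore
`g τ (η ⊕ η') = ∏_j gf (τ j) (increment of η ⊕ η' across face column j)`, a function of `η ⊕ η'` alone: the rows form a random
walk on `(ℤ/2)^{w+1}` with transfer matrix `K τ u v = g τ (u ⊕ v)`.  Its `d`-th power is EXPLICIT
(`K_pow_formula`): `(K τ ^ d) u v = A_d · ∏_{j iso} (1 ∓ ρ^d)` with `ρ = ρIK = 7 − 4√3 = (1−t)/(1+t)`, the sign read from the
increment of `u ⊕ v` across `j` (proof: induction on `d`; the sum over the intermediate row factorises over the face columns after the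
change of variables row ↦ (first cell, increments), `sum_prod_cj`).  Consequence (`K_pow_ratio`): for `d ≥ 2w + 2` all entries of
`K τ ^ d` are within the factor `5/4` of each other (`(1+ρ^d)^w ≤ 5/4 · (1−ρ^d)^w`, `pow_ratio_le`) — the `L∞` mixing of the row chain
used by the cylinder-to-plane comparison of `stub_cylPlane`.
-/

noncomputable section

namespace Summit.CriticalPhenomena.CardyFormulaZ2.Cruxes.IKMixedBoxCrossing.DefectClosureExploration

open scoped BigOperators Classical
open Finset

namespace CylPlane

variable {w : ℕ}

/-! ## §1 Rows, increments, the transfer matrix -/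

/-- A row of cell colours of the slab with `w` face columns (`w + 1` cells). -/
abbrev Row (w : ℕ) : Type := Fin (w + 1) → Bool

/-- Pointwise `xor` of two rows. -/
def rxor (u v : Row w) : Row w := fun i => u i ^^ v i

/-- The increment of a row across the face column `j` (do the two cells of the face in this row differ?). -/
def cj (ε : Row w) (j : Fin w) : Bool := ε j.castSucc ^^ ε j.succ

/-- `xor` by a fixed row is an involution. -/
theorem rxor_rxor_cancel (u v : Row w) : rxor u (rxor u v) = v := by
  funext i; simp [rxor]

/-- `xor` by a fixed row, as a permutation of the rows. -/
def rxorEquiv (u : Row w) : Row w ≃ Row w := ⟨rxor u, rxor u, rxor_rxor_cancel u, rxor_rxor_cancel u⟩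

/-- The increment across `j` of `(u ⊕ ε) ⊕ v` is that of `ε` corrected by that of `u ⊕ v`. -/
theorem cj_rxor_rxor (u ε v : Row w) (j : Fin w) : cj (rxor (rxor u ε) v) j = (cj ε j ^^ cj (rxor u v) j) := by
  simp only [cj, rxor]
  cases u j.castSucc <;> cases u j.succ <;> cases v j.castSucc <;> cases v j.succ <;> cases ε j.castSucc <;>
    cases ε j.succ <;> rfl

/-- Colour weight of a face of type `iso` and parity `b`, its flag summed out of `faceWeight`: `t^[b]` (`t = √3/2`) on an
isotropic face, `1` on a honeycomb face. -/
def gf (iso b : Bool) : ℝ := if iso = true ∧ b = true then Real.sqrt 3 / 2 else 1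

/-- `gf` is positive. -/
theorem gf_pos (iso b : Bool) : 0 < gf iso b := by
  unfold gf; split_ifs <;> positivity

/-- The transfer weight between two consecutive rows with `xor` `ε`, face types `τ`. -/
def g (τ : Fin w → Bool) (ε : Row w) : ℝ := ∏ j, gf (τ j) (cj ε j)

/-- The row transfer matrix of the slab colour law. -/
def K (τ : Fin w → Bool) : Matrix (Row w) (Row w) ℝ := Matrix.of fun u v => g τ (rxor u v)

/-! ## §2 The factorisation over face columns -/

/-- **Factorisation.** A product over the face columns of functions of the increments, summed over all rows, factorises
(change of variables row ↦ (first cell, increments); induction on the number of face columns). -/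
theorem sum_prod_cj : ∀ (w : ℕ) (H : Fin w → Bool → ℝ),
    ∑ ε : Row w, ∏ j, H j (cj ε j) = 2 * ∏ j, (H j false + H j true)
  | 0, H => by simp [Row]
  | w + 1, H => by
    rw [← (Fin.consEquiv fun _ : Fin (w + 2) => Bool).sum_comp, Fintype.sum_prod_type]
    have hcj0 : ∀ (b : Bool) (ε : Row w), cj (Fin.consEquiv (fun _ => Bool) (b, ε)) 0 = (b ^^ ε 0) := fun b ε => by
      simp [cj, Fin.consEquiv]
    have hcjs : ∀ (b : Bool) (ε : Row w) (j : Fin w),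
        cj (Fin.consEquiv (fun _ => Bool) (b, ε)) j.succ = cj ε j := fun b ε j => by
      simp only [cj, Fin.consEquiv, Equiv.coe_fn_mk]
      rw [← Fin.succ_castSucc, Fin.cons_succ, Fin.cons_succ]
    simp only [Fin.prod_univ_succ, hcj0, hcjs]
    rw [Finset.sum_comm]
    have hb : ∀ ε : Row w, ∑ b : Bool, H 0 (b ^^ ε 0) * ∏ j : Fin w, H j.succ (cj ε j) =
        (H 0 false + H 0 true) * ∏ j : Fin w, H j.succ (cj ε j) := fun ε => by
      rw [Fintype.sum_bool]
      cases ε 0 <;> simp <;> ring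
    simp only [hb]
    rw [← Finset.mul_sum, sum_prod_cj w (fun j => H j.succ)]
    ring

/-! ## §3 The explicit `d`-step kernel -/

/-- `ρ < 1`. -/
theorem ρIK_lt_one : ρIK < 1 := by linarith [seven_mul_ρIK_lt_one, ρIK_pos]

/-- `ρ ≤ 1/10` (`7 − 4√3 = 0.0718…`). -/
theorem ρIK_le_tenth : ρIK ≤ 1 / 10 := by
  have h3 : Real.sqrt 3 ^ 2 = 3 := Real.sq_sqrt (by norm_num)
  have h0 : 0 ≤ Real.sqrt 3 := Real.sqrt_nonneg 3
  rw [ρIK]; nlinarith [h3, h0]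

/-- `1 − t = ρ (1 + t)` at `t = √3/2`. -/
theorem one_sub_t_eq : 1 - Real.sqrt 3 / 2 = ρIK * (1 + Real.sqrt 3 / 2) := by
  have h3 : Real.sqrt 3 ^ 2 = 3 := Real.sq_sqrt (by norm_num)
  rw [ρIK]; nlinarith [h3]

/-- Per-face factor of the `d`-step kernel: `1 − ρ^d` across an isotropic face column where `u ⊕ v` has an increment,
`1 + ρ^d` where it has none, `1` across a honeycomb face column. -/
def φf (τ : Fin w → Bool) (d : ℕ) (j : Fin w) (b : Bool) : ℝ :=
  if τ j = true then (if b = true then 1 - ρIK ^ d else 1 + ρIK ^ d) else 1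

/-- **The `d`-step kernel in product form**: `(K τ ^ d) u v = A_d ∏_j φf τ d j (increment of u ⊕ v across j)`, `d ≥ 1`. -/
theorem K_pow_formula (τ : Fin w → Bool) (d : ℕ) (hd : 1 ≤ d) :
    ∃ A : ℝ, 0 < A ∧ ∀ u v : Row w, (K τ ^ d) u v = A * ∏ j, φf τ d j (cj (rxor u v) j) := by
  induction d, hd using Nat.le_induction with
  | base =>
    refine ⟨∏ j : Fin w, (if τ j = true then (1 + Real.sqrt 3 / 2) / 2 else 1), ?_, fun u v => ?_⟩
    · exact Finset.prod_pos fun j _ => by split_ifs <;> positivity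
    · rw [pow_one, K, Matrix.of_apply, g, ← Finset.prod_mul_distrib]
      refine Finset.prod_congr rfl fun j _ => ?_
      have h3 : Real.sqrt 3 ^ 2 = 3 := Real.sq_sqrt (by norm_num)
      unfold gf φf
      cases τ j <;> cases cj (rxor u v) j <;> simp [ρIK] <;> nlinarith [h3]
  | succ d hd ih =>
    obtain ⟨A, hA, hK⟩ := ih
    refine ⟨A * 2 * ∏ j : Fin w, (if τ j = true then 1 + Real.sqrt 3 / 2 else 2), ?_, fun u v => ?_⟩
    · have : 0 < ∏ j : Fin w, (if τ j = true then 1 + Real.sqrt 3 / 2 else (2 : ℝ)) :=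
        Finset.prod_pos fun j _ => by split_ifs <;> positivity
      positivity
    rw [pow_succ', Matrix.mul_apply]
    have step1 : ∑ m, K τ u m * (K τ ^ d) m v =
        ∑ ε : Row w, A * ∏ j, (gf (τ j) (cj ε j) * φf τ d j (cj ε j ^^ cj (rxor u v) j)) := by
      rw [← (rxorEquiv u).sum_comp]
      refine Finset.sum_congr rfl fun ε _ => ?_
      have e1 : (rxorEquiv u) ε = rxor u ε := rfl
      rw [e1, hK, K, Matrix.of_apply, rxor_rxor_cancel, g, ← mul_assoc, mul_comm (∏ j, gf _ _) A, mul_assoc,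
        ← Finset.prod_mul_distrib]
      congr 1
      exact Finset.prod_congr rfl fun j _ => by rw [cj_rxor_rxor]
    rw [step1, ← Finset.mul_sum, sum_prod_cj w (fun j b => gf (τ j) b * φf τ d j (b ^^ cj (rxor u v) j))]
    rw [show A * (2 * ∏ j, (gf (τ j) false * φf τ d j (false ^^ cj (rxor u v) j) +
        gf (τ j) true * φf τ d j (true ^^ cj (rxor u v) j))) =
        A * 2 * ∏ j, (gf (τ j) false * φf τ d j (false ^^ cj (rxor u v) j) +
          gf (τ j) true * φf τ d j (true ^^ cj (rxor u v) j)) by ring, mul_assoc (A * 2), ← Finset.prod_mul_distrib]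
    congr 1
    refine Finset.prod_congr rfl fun j _ => ?_
    have hρ := one_sub_t_eq
    unfold gf φf
    -- honeycomb: `1 + 1 = 2`; the two isotropic cases differ by the sign of the `ρ^d` correction
    cases τ j <;> cases cj (rxor u v) j <;> simp [pow_succ] <;>
      first | linear_combination (ρIK ^ d) * hρ | linear_combination (-(ρIK ^ d)) * hρ | norm_num

/-- Bounds of the per-face factor. -/
theorem φf_bounds (τ : Fin w → Bool) (d : ℕ) (j : Fin w) (b : Bool) :
    1 - ρIK ^ d ≤ φf τ d j b ∧ φf τ d j b ≤ 1 + ρIK ^ d := by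
  have h0 : 0 ≤ ρIK ^ d := pow_nonneg ρIK_pos.le d
  unfold φf; split_ifs <;> constructor <;> linarith

/-- Two-sided bounds of the `d`-step kernel: `A (1−ρ^d)^w ≤ (K τ ^ d) u v ≤ A (1+ρ^d)^w`. -/
theorem K_pow_bounds (τ : Fin w → Bool) (d : ℕ) (hd : 1 ≤ d) :
    ∃ A : ℝ, 0 < A ∧ ∀ u v : Row w,
      A * (1 - ρIK ^ d) ^ w ≤ (K τ ^ d) u v ∧ (K τ ^ d) u v ≤ A * (1 + ρIK ^ d) ^ w := by
  obtain ⟨A, hA, hK⟩ := K_pow_formula τ d hd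
  refine ⟨A, hA, fun u v => ?_⟩
  have h1 : ρIK ^ d ≤ 1 := pow_le_one₀ ρIK_pos.le ρIK_lt_one.le
  rw [hK u v]
  constructor
  · refine mul_le_mul_of_nonneg_left ?_ hA.le
    calc (1 - ρIK ^ d) ^ w = ∏ _j : Fin w, (1 - ρIK ^ d) := by simp
      _ ≤ _ := Finset.prod_le_prod (fun j _ => by linarith) (fun j _ => (φf_bounds τ d j _).1)
  · refine mul_le_mul_of_nonneg_left ?_ hA.le
    calc ∏ j, φf τ d j (cj (rxor u v) j) ≤ ∏ _j : Fin w, (1 + ρIK ^ d) :=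
          Finset.prod_le_prod (fun j _ => by linarith [(φf_bounds τ d j (cj (rxor u v) j)).1])
            (fun j _ => (φf_bounds τ d j _).2)
      _ = (1 + ρIK ^ d) ^ w := by simp

/-! ## §4 The mixing bound -/

/-- Numerical heart of the mixing bound: `(1 + ρ^d)^w ≤ 5/4 · (1 − ρ^d)^w` once `d ≥ 2w + 2`
(`w ρ^d ≤ 1/100`, `(1+x)/(1−x) ≤ 1 + 3x ≤ e^{3x}`, `e^{3wx} ≤ 1 + 6wx`). -/
theorem pow_ratio_le (w d : ℕ) (hd : 2 * w + 2 ≤ d) : (1 + ρIK ^ d) ^ w ≤ 5 / 4 * (1 - ρIK ^ d) ^ w := by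
  set x : ℝ := ρIK ^ d with hx
  have hρ0 := ρIK_pos
  have hρ1 := ρIK_le_tenth
  have hx0 : 0 ≤ x := pow_nonneg hρ0.le d
  have hx1 : x ≤ (1 / 100) ^ (w + 1) := by
    calc x ≤ ρIK ^ (2 * w + 2) := pow_le_pow_of_le_one hρ0.le ρIK_lt_one.le hd
      _ = (ρIK ^ 2) ^ (w + 1) := by rw [← pow_mul]; ring_nf
      _ ≤ (1 / 100) ^ (w + 1) := pow_le_pow_left₀ (by positivity) (by nlinarith) _
  have hw2 : (w : ℝ) * (1 / 2) ^ w ≤ 1 := by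
    have h := Nat.lt_two_pow_self (n := w)
    have h' : (w : ℝ) < 2 ^ w := by exact_mod_cast h
    rw [one_div_pow, mul_one_div, div_le_one (by positivity)]
    exact h'.le
  have hx2 : x ≤ 1 / 100 * (1 / 2) ^ w := by
    refine hx1.trans ?_
    rw [pow_succ']
    exact mul_le_mul_of_nonneg_left (pow_le_pow_left₀ (by norm_num) (by norm_num) w) (by norm_num)
  have hwx : (w : ℝ) * x ≤ 1 / 100 := by
    calc (w : ℝ) * x ≤ w * (1 / 100 * (1 / 2) ^ w) := mul_le_mul_of_nonneg_left hx2 (Nat.cast_nonneg w)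
      _ = 1 / 100 * (w * (1 / 2) ^ w) := by ring
      _ ≤ 1 / 100 * 1 := mul_le_mul_of_nonneg_left hw2 (by norm_num)
      _ = 1 / 100 := by ring
  have hx3 : x ≤ 1 / 100 := by
    calc x ≤ (1 / 100) ^ (w + 1) := hx1
      _ ≤ (1 / 100) ^ 1 := pow_le_pow_of_le_one (by norm_num) (by norm_num) (by omega)
      _ = 1 / 100 := by norm_num
  have hA : (1 + x) ^ w ≤ ((1 + 3 * x) * (1 - x)) ^ w :=
    pow_le_pow_left₀ (by linarith) (by nlinarith) w
  rw [mul_pow] at hA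
  have hB : (1 + 3 * x) ^ w ≤ 5 / 4 := by
    have h1 : (1 + 3 * x) ^ w ≤ Real.exp (3 * x) ^ w :=
      pow_le_pow_left₀ (by linarith) (by linarith [Real.add_one_le_exp (3 * x)]) w
    have h2 : Real.exp (3 * x) ^ w = Real.exp (w * (3 * x)) := (Real.exp_nat_mul _ _).symm
    have h3 : |(w : ℝ) * (3 * x)| ≤ 1 := by
      rw [abs_of_nonneg (by positivity)]; nlinarith
    have h4 := Real.abs_exp_sub_one_le h3
    rw [abs_of_nonneg (by positivity : (0 : ℝ) ≤ w * (3 * x))] at h4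
    have h5 : Real.exp (w * (3 * x)) ≤ 1 + 2 * (w * (3 * x)) := by
      have := (abs_le.1 h4).2; linarith
    calc (1 + 3 * x) ^ w ≤ Real.exp (w * (3 * x)) := h1.trans h2.le
      _ ≤ 1 + 2 * (w * (3 * x)) := h5
      _ ≤ 5 / 4 := by nlinarith
  have hC : 0 ≤ (1 - x) ^ w := pow_nonneg (by linarith) w
  calc (1 + x) ^ w ≤ (1 + 3 * x) ^ w * (1 - x) ^ w := hA
    _ ≤ 5 / 4 * (1 - x) ^ w := mul_le_mul_of_nonneg_right hB hC

/-- **`L∞` MIXING of the row chain**: for `d ≥ 2w + 2` all entries of `K τ ^ d` are positive and within the factor `5/4`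
of one another. -/
theorem K_pow_ratio (τ : Fin w → Bool) (d : ℕ) (hd : 2 * w + 2 ≤ d) (u v u' v' : Row w) :
    0 < (K τ ^ d) u v ∧ (K τ ^ d) u v ≤ 5 / 4 * (K τ ^ d) u' v' := by
  obtain ⟨A, hA, hK⟩ := K_pow_bounds τ d (by omega)
  have hlt : ρIK ^ d < 1 := pow_lt_one₀ ρIK_pos.le ρIK_lt_one (by omega)
  have hpos : 0 < A * (1 - ρIK ^ d) ^ w := mul_pos hA (pow_pos (by linarith) w)
  refine ⟨hpos.trans_le (hK u v).1, ?_⟩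
  calc (K τ ^ d) u v ≤ A * (1 + ρIK ^ d) ^ w := (hK u v).2
    _ ≤ A * (5 / 4 * (1 - ρIK ^ d) ^ w) := mul_le_mul_of_nonneg_left (pow_ratio_le w d hd) hA.le
    _ = 5 / 4 * (A * (1 - ρIK ^ d) ^ w) := by ring
    _ ≤ 5 / 4 * (K τ ^ d) u' v' := mul_le_mul_of_nonneg_left (hK u' v').1 (by norm_num)

end CylPlane

/-- **Registered helper `cylPlane_rowKernel_mixing`** (line `defect-closure-exploration`, stub `stub_cylPlane`, step (iii)):
the `d`-step row kernel of the slab colour law has all its entries positive and within the factor `5/4` of one another as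
soon as `d ≥ 2w + 2` (`w` face columns). -/
theorem cylPlane_rowKernel_mixing : ∀ {w : ℕ} (τ : Fin w → Bool) (d : ℕ), 2 * w + 2 ≤ d →
    ∀ u v u' v' : CylPlane.Row w, 0 < (CylPlane.K τ ^ d) u v ∧ (CylPlane.K τ ^ d) u v ≤ 5 / 4 * (CylPlane.K τ ^ d) u' v' :=
  fun τ d hd u v u' v' => CylPlane.K_pow_ratio τ d hd u v u' v'

end Summit.CriticalPhenomena.CardyFormulaZ2.Cruxes.IKMixedBoxCrossing.DefectClosureExploration

end
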